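import Summits.KontsevichZagierPeriods.KontsevichZagierPeriods.Theorems.MzvKernelInKZ.Negative.HalfAngle

/-!
# `MzvKernelInKZ` (stmt-KontsevichZagierPeriods-3914): negative side — the line `[ℝ, dt/(1+t²)] ≡ 4·[(0,1), dt/(1+t²)]` and `Q ≡ 2·[(0,1), dt/(1+t²)]`

Companion of `Negative/HalfAngle.lean` (the element `[π]`, continued in `PiDisc.lean`).  One-dimensional
representations `[S, dt/(1+t²)]` over `ℚ`-semialgebraic `S ⊆ ℝ¹`; the line is cut at `0, ±1` (rule
(1a), null points) and folded onto `(0,1)` by `t ↦ −t` and `t ↦ 1/t` (rule (2), `dt/(1+t²)` being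
invariant): `[ℝ, dt/(1+t²)] − 4 • [(0,1), dt/(1+t²)] ∈ KZ.relations` (`line_univ_sub_four_mem`), and
`Q = [(0,1), 2dt/(1+t²)] ≡ 2·[(0,1), dt/(1+t²)]` (`Qrep_sub_two_line_mem`).

Sources: M. Kontsevich, D. Zagier, *Periods* (2001), §1.1 (the first example `π = ∬_{x²+y²≤1} dx dy = ∫ dx/(1+x²)`), §1.2 (rules (1)–(3)).
-/

noncomputable section

namespace Summit.KontsevichZagierPeriods.MzvKernelInKZ.Negative

open Set MeasureTheory MvPolynomial
open Literature.NumberTheory.Transcendental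
open Literature.ModelTheory.ExponentialFields (IsSemialgebraic)

/-- `h(t) = 1/(1+t²) = g(t)/2`. [folklore] -/
def hq (t : ℝ) : ℝ := 1 / (1 + t ^ 2)

/-- `h = g/2`. [folklore] -/
theorem hq_eq (t : ℝ) : hq t = gq t / 2 := by unfold hq gq; ring

/-- `h > 0`. [folklore] -/
theorem hq_pos (t : ℝ) : 0 < hq t := by unfold hq; exact div_pos one_pos (one_add_sq_pos t)

/-- `h` is continuous on `ℝ¹`. [folklore] -/
theorem continuous_hq1 : Continuous fun x : Fin 1 → ℝ => hq (x 0) := by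
  unfold hq
  exact continuous_const.div (continuous_const.add ((continuous_apply 0).pow 2)) fun x => one_add_sq_ne _

/-- `t ↦ 1/(1+t²)` is integrable on `ℝ¹`. [folklore] -/
theorem integrable_hq1 : Integrable (fun x : Fin 1 → ℝ => hq (x 0)) volume := by
  have h := (MeasureTheory.volume_preserving_funUnique (Fin 1) ℝ).integrable_comp_emb
    (MeasurableEquiv.funUnique (Fin 1) ℝ).measurableEmbedding (g := fun t : ℝ => (1 + t ^ 2)⁻¹)
  have e : (fun x : Fin 1 → ℝ => hq (x 0)) = (fun t : ℝ => (1 + t ^ 2)⁻¹) ∘ (MeasurableEquiv.funUnique (Fin 1) ℝ) := by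
    funext x; simp [hq, MeasurableEquiv.funUnique, Fin.default_eq_zero]
  rw [e]
  exact h.mpr integrable_inv_one_add_sq

/-- `h` is `ℚ`-semialgebraic on any semialgebraic subset of `ℝ¹`. [folklore] -/
theorem isSemialgebraicFunOn_hq1 {S : Set (Fin 1 → ℝ)} (hS : IsSemialgebraic ℚ S) :
    IsSemialgebraicFunOn ℚ S fun x => hq (x 0) := by
  refine (isSemialgebraicFunOn_aeval_div_aeval hS (1 : MvPolynomial (Fin 1) ℚ) (1 + X 0 ^ 2) fun x _ => ?_).congr
    fun x _ => ?_
  · simp only [map_add, map_one, map_pow, aeval_X]; exact one_add_sq_ne _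
  · simp [hq]

/-- `[S, dt/(1+t²)]` for a semialgebraic `S ⊆ ℝ¹`. [folklore] -/
def lineRep (S : Set (Fin 1 → ℝ)) (hS : IsSemialgebraic ℚ S) : KZ.IntegralRep 1 :=
  ⟨S, fun x => hq (x 0), hS, isSemialgebraicFunOn_hq1 hS, integrable_hq1.integrableOn⟩

/-- Open intervals with rational endpoints are `ℚ`-semialgebraic in `ℝ¹`. [folklore] -/
theorem sa_Ioo1 (a b : ℚ) : IsSemialgebraic ℚ {x : Fin 1 → ℝ | (a : ℝ) < x 0 ∧ x 0 < b} := by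
  have e : {x : Fin 1 → ℝ | (a : ℝ) < x 0 ∧ x 0 < b} =
      {x | 0 < aeval x (X 0 - C a : MvPolynomial (Fin 1) ℚ)} ∩ {x | 0 < aeval x (C b - X 0 : MvPolynomial (Fin 1) ℚ)} := by
    ext x; simp [sub_pos]
  rw [e]
  exact (Literature.ModelTheory.ExponentialFields.isSemialgebraic_setOf_eval_pos _).inter
    (Literature.ModelTheory.ExponentialFields.isSemialgebraic_setOf_eval_pos _)

/-- Rational rays are `ℚ`-semialgebraic. [folklore] -/
theorem sa_Ioi1 (a : ℚ) : IsSemialgebraic ℚ {x : Fin 1 → ℝ | (a : ℝ) < x 0} := by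
  have e : {x : Fin 1 → ℝ | (a : ℝ) < x 0} = {x | 0 < aeval x (X 0 - C a : MvPolynomial (Fin 1) ℚ)} := by
    ext x; simp [sub_pos]
  rw [e]; exact Literature.ModelTheory.ExponentialFields.isSemialgebraic_setOf_eval_pos _

/-- Rational rays are `ℚ`-semialgebraic. [folklore] -/
theorem sa_Iio1 (a : ℚ) : IsSemialgebraic ℚ {x : Fin 1 → ℝ | x 0 < (a : ℝ)} := by
  have e : {x : Fin 1 → ℝ | x 0 < (a : ℝ)} = {x | 0 < aeval x (C a - X 0 : MvPolynomial (Fin 1) ℚ)} := by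
    ext x; simp [sub_pos]
  rw [e]; exact Literature.ModelTheory.ExponentialFields.isSemialgebraic_setOf_eval_pos _

/-- `ℝ¹` is `ℚ`-semialgebraic. [folklore] -/
theorem sa_univ1 : IsSemialgebraic ℚ (univ : Set (Fin 1 → ℝ)) :=
  Literature.ModelTheory.ExponentialFields.isSemialgebraic_univ

/-- The four pieces of the line. [folklore] -/
def L01 : Set (Fin 1 → ℝ) := {x | (0 : ℝ) < x 0 ∧ x 0 < 1}
/-- The piece `(1,∞)` of the line. [folklore] -/
def L1i : Set (Fin 1 → ℝ) := {x | (1 : ℝ) < x 0}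
/-- The piece `(−1,0)` of the line. [folklore] -/
def Lm10 : Set (Fin 1 → ℝ) := {x | (-1 : ℝ) < x 0 ∧ x 0 < 0}
/-- The piece `(−∞,−1)` of the line. [folklore] -/
def Lmi1 : Set (Fin 1 → ℝ) := {x | x 0 < (-1 : ℝ)}

/-- `L01` is `ℚ`-semialgebraic. [folklore] -/
theorem sa_L01 : IsSemialgebraic ℚ L01 := by simpa [L01] using sa_Ioo1 0 1
/-- `L1i` is `ℚ`-semialgebraic. [folklore] -/
theorem sa_L1i : IsSemialgebraic ℚ L1i := by simpa [L1i] using sa_Ioi1 1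
/-- `Lm10` is `ℚ`-semialgebraic. [folklore] -/
theorem sa_Lm10 : IsSemialgebraic ℚ Lm10 := by simpa [Lm10] using sa_Ioo1 (-1) 0
/-- `Lmi1` is `ℚ`-semialgebraic. [folklore] -/
theorem sa_Lmi1 : IsSemialgebraic ℚ Lmi1 := by simpa [Lmi1] using sa_Iio1 (-1)

/-- A one-dimensional change of variables `t ↦ φ t` with `h(φ t)|φ'(t)| = h(t)`, as a move between line
representations. [folklore] -/
theorem lineRep_cov {S T : Set (Fin 1 → ℝ)} (hS : IsSemialgebraic ℚ S) (hT : IsSemialgebraic ℚ T)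
    (φ : ℝ → ℝ) (φ' : ℝ → ℝ) (hφs : IsSemialgebraicFunOn ℚ S fun x => φ (x 0))
    (hd : ∀ x ∈ S, HasDerivAt φ (φ' (x 0)) (x 0)) (hinj : InjOn (fun x : Fin 1 → ℝ => (fun _ : Fin 1 => φ (x 0))) S)
    (him : (fun x : Fin 1 → ℝ => (fun _ : Fin 1 => φ (x 0))) '' S = T)
    (hint : ∀ x ∈ S, hq (x 0) = hq (φ (x 0)) * |φ' (x 0)|) :
    KZ.of (lineRep S hS) - KZ.of (lineRep T hT) ∈ KZ.changeOfVariablesRel := by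
  refine ⟨1, lineRep S hS, lineRep T hT, fun x _ => φ (x 0),
    fun x => LinearMap.toContinuousLinearMap (Matrix.toLin' !![φ' (x 0)]), ?_, fun x hx => ?_, hinj, him.symm,
    fun x hx => ?_, rfl⟩
  · show IsSemialgebraicMapOn ℚ S fun x _ => φ (x 0)
    exact IsSemialgebraicMapOn.of_forall hS fun _ => hφs
  · have p0 : HasFDerivAt (fun y : Fin 1 → ℝ => y 0)
        (ContinuousLinearMap.proj (R := ℝ) (φ := fun _ : Fin 1 => ℝ) 0) x := hasFDerivAt_apply 0 x
    have h1 := (hd x hx).comp_hasFDerivAt x p0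
    have c : HasFDerivAt (fun y : Fin 1 → ℝ => φ (y 0))
        ((ContinuousLinearMap.proj 0).comp (LinearMap.toContinuousLinearMap (Matrix.toLin' !![φ' (x 0)]))) x := by
      refine h1.congr_fderiv ?_
      ext v; simp [dotProduct, mul_comm]
    exact (hasFDerivAt_pi'.mpr fun i => by fin_cases i; exact c).hasFDerivWithinAt
  · change hq (x 0) = hq (φ (x 0)) * |(LinearMap.toContinuousLinearMap (Matrix.toLin' !![φ' (x 0)])).det|
    have : (LinearMap.toContinuousLinearMap (Matrix.toLin' !![φ' (x 0)])).det = φ' (x 0) := by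
      show LinearMap.det (Matrix.toLin' !![φ' (x 0)]) = φ' (x 0)
      rw [LinearMap.det_toLin']
      try simp
    rw [this]; exact hint x hx

/-- `(1,∞) ≅ (0,1)` by `t ↦ 1/t`. [folklore] -/
theorem L1i_cov : KZ.of (lineRep L1i sa_L1i) - KZ.of (lineRep L01 sa_L01) ∈ KZ.changeOfVariablesRel := by
  refine lineRep_cov sa_L1i sa_L01 (fun t => t⁻¹) (fun t => -(t ^ 2)⁻¹) ?_ (fun x hx => ?_) ?_ ?_ (fun x hx => ?_)
  · refine (isSemialgebraicFunOn_aeval_div_aeval sa_L1i (1 : MvPolynomial (Fin 1) ℚ) (X 0) fun x hx => ?_).congr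
      fun x _ => by simp
    have : (1 : ℝ) < x 0 := hx
    simp only [aeval_X]; linarith
  · have : (1 : ℝ) < x 0 := hx
    exact hasDerivAt_inv (by linarith)
  · intro x hx y hy h
    have : (x 0)⁻¹ = (y 0)⁻¹ := congrFun h 0
    funext i; fin_cases i; simpa using inv_inj.mp this
  · apply Subset.antisymm
    · rintro _ ⟨x, hx, rfl⟩
      have : (1 : ℝ) < x 0 := hx
      exact ⟨by simp; positivity, by simpa using inv_lt_one_of_one_lt₀ this⟩
    · intro y hy
      obtain ⟨h0, h1⟩ := hy
      refine ⟨fun _ => (y 0)⁻¹, (one_lt_inv₀ h0).mpr h1, ?_⟩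
      funext i; fin_cases i; simp
  · have : (1 : ℝ) < x 0 := hx
    have hx0 : x 0 ≠ 0 := by linarith
    rw [abs_of_neg (by simp; positivity)]
    simp only [hq]
    field_simp
    ring

/-- `h` is even. [folklore] -/
theorem hq_neg (t : ℝ) : hq (-t) = hq t := by simp [hq]

/-- `(−1,0) ≅ (0,1)` by `t ↦ −t`. [folklore] -/
theorem Lm10_cov : KZ.of (lineRep Lm10 sa_Lm10) - KZ.of (lineRep L01 sa_L01) ∈ KZ.changeOfVariablesRel := by
  refine lineRep_cov sa_Lm10 sa_L01 (fun t => -t) (fun _ => -1) ?_ (fun x _ => ?_) ?_ ?_ (fun x _ => ?_)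
  · simpa using (isSemialgebraicFunOn_aeval sa_Lm10 (-X 0 : MvPolynomial (Fin 1) ℚ))
  · exact (hasDerivAt_id' (x 0)).neg
  · intro x _ y _ h
    have : -x 0 = -y 0 := congrFun h 0
    funext i; fin_cases i; simpa using neg_inj.mp this
  · apply Subset.antisymm
    · rintro _ ⟨x, ⟨h0, h1⟩, rfl⟩; exact ⟨by simp; linarith, by simp; linarith⟩
    · intro y ⟨h0, h1⟩
      exact ⟨fun _ => -y 0, ⟨by linarith, by linarith⟩, by funext i; fin_cases i; simp⟩
  · rw [hq_neg]; simp

/-- `(−∞,−1) ≅ (1,∞)` by `t ↦ −t`. [folklore] -/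
theorem Lmi1_cov : KZ.of (lineRep Lmi1 sa_Lmi1) - KZ.of (lineRep L1i sa_L1i) ∈ KZ.changeOfVariablesRel := by
  refine lineRep_cov sa_Lmi1 sa_L1i (fun t => -t) (fun _ => -1) ?_ (fun x _ => ?_) ?_ ?_ (fun x _ => ?_)
  · simpa using (isSemialgebraicFunOn_aeval sa_Lmi1 (-X 0 : MvPolynomial (Fin 1) ℚ))
  · exact (hasDerivAt_id' (x 0)).neg
  · intro x _ y _ h
    have : -x 0 = -y 0 := congrFun h 0
    funext i; fin_cases i; simpa using neg_inj.mp this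
  · apply Subset.antisymm
    · rintro _ ⟨x, hx, rfl⟩
      have : x 0 < -1 := hx
      show (1 : ℝ) < -x 0; linarith
    · intro y hy
      have : (1 : ℝ) < y 0 := hy
      exact ⟨fun _ => -y 0, show -y 0 < -1 by linarith, by funext i; fin_cases i; simp⟩
  · rw [hq_neg]; simp

/-- Peeling for line representations. [folklore] -/
theorem line_peel {T : Set (Fin 1 → ℝ)} (hT : IsSemialgebraic ℚ T) {P : Set (Fin 1 → ℝ)} (hP : IsSemialgebraic ℚ P)
    (hPT : P ⊆ T) :
    KZ.of (lineRep T hT) - KZ.of (lineRep P hP) - KZ.of (lineRep (T \ P) (hT.diff hP)) ∈ KZ.domainAddRel := by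
  refine ⟨1, lineRep T hT, lineRep P hP, lineRep (T \ P) (hT.diff hP), ?_, ?_, fun _ _ => rfl, fun _ _ => rfl, rfl⟩
  · change T = P ∪ (T \ P); rw [Set.union_sdiff_cancel hPT]
  · change volume (P ∩ (T \ P)) = 0; rw [Set.inter_sdiff_self, measure_empty]

/-- Points of `ℝ¹` are null. [folklore] -/
theorem volume_pt1 (a : ℝ) : volume {x : Fin 1 → ℝ | x 0 = a} = 0 := by
  have e : {x : Fin 1 → ℝ | x 0 = a} = Set.pi univ fun _ => {a} := by
    ext x; simp [Fin.forall_fin_one]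
  rw [e, volume_pi_pi]; simp

/-- **`[ℝ, dt/(1+t²)] ≡ 4·[(0,1), dt/(1+t²)]`.** [folklore] -/
theorem line_univ_sub_four_mem :
    KZ.of (lineRep univ sa_univ1) - 4 • KZ.of (lineRep L01 sa_L01) ∈ KZ.relations := by
  -- peel L01, L1i, Lm10, Lmi1; remainder = {0, 1, −1} null
  have d1 := KZ.domainAddRel_subset_relations (line_peel sa_univ1 sa_L01 (subset_univ _))
  have s2 : L1i ⊆ univ \ L01 := fun x hx => ⟨trivial, fun h => by have := h.2; have : (1:ℝ) < x 0 := hx; linarith⟩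
  have d2 := KZ.domainAddRel_subset_relations (line_peel (sa_univ1.diff sa_L01) sa_L1i s2)
  have s3 : Lm10 ⊆ (univ \ L01) \ L1i := fun x hx => ⟨⟨trivial, fun h => by linarith [h.1, hx.2]⟩,
    fun h => by have : (1:ℝ) < x 0 := h; linarith [hx.2]⟩
  have d3 := KZ.domainAddRel_subset_relations (line_peel ((sa_univ1.diff sa_L01).diff sa_L1i) sa_Lm10 s3)
  have s4 : Lmi1 ⊆ ((univ \ L01) \ L1i) \ Lm10 := fun x hx => by
    have : x 0 < -1 := hx
    exact ⟨⟨⟨trivial, fun h => by linarith [h.1]⟩, fun h => by have : (1:ℝ) < x 0 := h; linarith⟩,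
      fun h => by linarith [h.1]⟩
  have d4 := KZ.domainAddRel_subset_relations
    (line_peel (((sa_univ1.diff sa_L01).diff sa_L1i).diff sa_Lm10) sa_Lmi1 s4)
  have hnull : volume ((((univ \ L01) \ L1i) \ Lm10) \ Lmi1) = 0 := by
    have hsub : (((univ \ L01) \ L1i) \ Lm10) \ Lmi1 ⊆
        {x : Fin 1 → ℝ | x 0 = 0} ∪ {x | x 0 = 1} ∪ {x | x 0 = -1} := by
      rintro x ⟨⟨⟨⟨-, n1⟩, n2⟩, n3⟩, n4⟩
      simp only [L01, L1i, Lm10, Lmi1, mem_setOf_eq, not_and, not_lt] at n1 n2 n3 n4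
      simp only [mem_union, mem_setOf_eq]
      by_contra hc
      simp only [not_or] at hc
      obtain ⟨⟨c0, c1⟩, cm⟩ := hc
      rcases lt_or_gt_of_ne c0 with h | h
      · rcases lt_or_gt_of_ne cm with h' | h'
        · exact absurd h' (not_lt.mpr n4)
        · exact absurd h (not_lt.mpr (n3 h'))
      · rcases lt_or_gt_of_ne c1 with h' | h'
        · exact absurd h' (not_lt.mpr (n1 h))
        · exact absurd h' (not_lt.mpr n2)
    exact measure_mono_null hsub (measure_union_null (measure_union_null (volume_pt1 0) (volume_pt1 1)) (volume_pt1 (-1)))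
  have d5 : KZ.of (lineRep ((((univ \ L01) \ L1i) \ Lm10) \ Lmi1)
      ((((sa_univ1.diff sa_L01).diff sa_L1i).diff sa_Lm10).diff sa_Lmi1)) ∈ KZ.relations :=
    KZ.levelRel_le_relations (KZ.of_mem_levelRel_of_volume_eq_zero _ hnull)
  have c1 := KZ.changeOfVariablesRel_subset_relations L1i_cov
  have c2 := KZ.changeOfVariablesRel_subset_relations Lm10_cov
  have c3 := KZ.changeOfVariablesRel_subset_relations Lmi1_cov
  set U := KZ.of (lineRep univ sa_univ1)
  set A := KZ.of (lineRep L01 sa_L01); set B := KZ.of (lineRep L1i sa_L1i)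
  set C := KZ.of (lineRep Lm10 sa_Lm10); set D := KZ.of (lineRep Lmi1 sa_Lmi1)
  set R1 := KZ.of (lineRep (univ \ L01) (sa_univ1.diff sa_L01))
  set R2 := KZ.of (lineRep ((univ \ L01) \ L1i) ((sa_univ1.diff sa_L01).diff sa_L1i))
  set R3 := KZ.of (lineRep (((univ \ L01) \ L1i) \ Lm10) (((sa_univ1.diff sa_L01).diff sa_L1i).diff sa_Lm10))
  set R4 := KZ.of (lineRep ((((univ \ L01) \ L1i) \ Lm10) \ Lmi1)
      ((((sa_univ1.diff sa_L01).diff sa_L1i).diff sa_Lm10).diff sa_Lmi1))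
  have : U - 4 • A = (U - A - R1) + (R1 - B - R2) + (R2 - C - R3) + (R3 - D - R4) + R4 + 2 • (B - A) + (C - A)
      + (D - B) := by abel
  rw [this]
  exact add_mem (add_mem (add_mem (add_mem (add_mem (add_mem (add_mem d1 d2) d3) d4) d5)
    (KZ.relations.nsmul_mem c1 2)) c2) c3

/-- `Q = [(0,1), 2dt/(1+t²)] ≡ 2·[(0,1), dt/(1+t²)]` (one integrand additivity). [folklore] -/
theorem Qrep_sub_two_line_mem : KZ.of Qrep - 2 • KZ.of (lineRep L01 sa_L01) ∈ KZ.relations := by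
  have hdom : (lineRep L01 sa_L01).domain = Qrep.domain := by
    ext x; rw [Qrep_domain, mem_cube1]; rfl
  have h := KZ.integrandAddRel_subset_relations ⟨1, Qrep, lineRep L01 sa_L01, lineRep L01 sa_L01, hdom, hdom,
    fun x _ => by simp [lineRep, hq_eq], rfl⟩
  simpa [two_nsmul, sub_sub] using h

end Summit.KontsevichZagierPeriods.MzvKernelInKZ.Negative
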